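import Literature.MathematicalPhysics.QuantumLattice.DWaveGapLatticeCount
import HarnessLib

/-!
# Lattice momenta near the Fermi curve of the square-lattice band: a count linear in `L`

Topic `MathematicalPhysics/QuantumLattice`, family `hubbard` (written for route
`HubbardSuperconductivity/SpinStructureRigidity`, item `SsrFreeParityCollapse`).

**The count.** For the nearest-neighbour band `ξ(p) = -2(cos p₁ + cos p₂) - μ` with `μ ∈ (-4, 4)`
(so that the Fermi curve `ξ = 0` is a genuine curve in the Brillouin zone), uniformly in a shift
`s ∈ ℝ²` of the momentum grid `p = 2πk/L - s`, `k ∈ (ℤ/Lℤ)²`, at least `c L` grid momenta lie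
within `2π/L` of the Fermi curve in energy:

  `c L ≤ #{k ∈ (ℤ/Lℤ)² : |ξ(2πk/L - s)| ≤ 2π/L}`     (`exists_card_abs_band_le`),

for all `L ≥ L₁(μ)`, with `c = c(μ) > 0`. Proof (elementary): near the diagonal point
`(u*, u*)`, `cos u* = -μ/4`, the Fermi curve is the graph `p₂ = arccos(-μ/2 - cos p₁)` over
`|p₁ - u*| ≤ ε = 1 - |μ|/4`; each of the `≥ εL/π - 1` grid columns `p₁` in that window has a grid
row `p₂` within `π/L` of the graph, where `|ξ| ≤ 2|cos p₂ - cos(graph)| ≤ 2π/L`.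
(The shifted grid is the momentum grid of a torus with twisted boundary conditions in the boost
gauge, Shastry–Sutherland 1990; the count is the lattice version of "the Fermi curve has positive
length".) No definition is introduced.
-/

namespace Literature.MathematicalPhysics.QuantumLattice

open Finset Real
open Literature.Probability.LatticeModels

variable {L : ℕ} [NeZero L]

/-- Casting an integer to `ℤ/Lℤ` changes the lattice angle by a multiple of `2π`. [folklore] -/
theorem cos_two_pi_mul_val_intCast_div_sub (j : ℤ) (s : ℝ) :
    Real.cos (2 * π * (((j : ZMod L).val : ℕ) : ℝ) / L - s) = Real.cos (2 * π * (j : ℝ) / L - s) := by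
  have hL : (L : ℝ) ≠ 0 := Nat.cast_ne_zero.mpr (NeZero.ne L)
  have hv : ((((j : ZMod L).val : ℕ) : ℤ) : ℝ) = ((j % (L : ℤ) : ℤ) : ℝ) := by
    rw [ZMod.val_intCast]
  rw [Int.cast_natCast] at hv
  rw [hv, Int.emod_def, Int.cast_sub, Int.cast_mul, Int.cast_natCast,
    show 2 * π * ((j : ℝ) - (L : ℝ) * ((j / (L : ℤ) : ℤ) : ℝ)) / L - s =
      2 * π * (j : ℝ) / L - s - ((j / (L : ℤ) : ℤ) : ℝ) * (2 * π) by field_simp; ring,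
    Real.cos_sub_int_mul_two_pi]

omit [NeZero L] in
/-- **One grid row per column**: if `|m - cos a| ≤ 1`, some grid angle `2πb/L - s₁` has
`|cos a + cos(2πb/L - s₁) - m| ≤ π/L` (take `b` the nearest integer to `(arccos(m - cos a) + s₁)L/2π`).
[folklore] -/
theorem exists_int_abs_cos_add_cos_sub_le (hL : (0 : ℝ) < L) (m s₁ a : ℝ) (hm : |m - Real.cos a| ≤ 1) :
    ∃ b : ℤ, |Real.cos a + Real.cos (2 * π * (b : ℝ) / L - s₁) - m| ≤ π / L := by
  set v := Real.arccos (m - Real.cos a) with hvdef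
  have hv : Real.cos v = m - Real.cos a := by
    rw [abs_le] at hm
    exact Real.cos_arccos (by linarith) (by linarith)
  refine ⟨round ((v + s₁) * L / (2 * π)), ?_⟩
  have hr := abs_sub_round ((v + s₁) * L / (2 * π))
  have hdist : |2 * π * ((round ((v + s₁) * L / (2 * π)) : ℤ) : ℝ) / L - s₁ - v| ≤ π / L := by
    have e : 2 * π * ((round ((v + s₁) * L / (2 * π)) : ℤ) : ℝ) / L - s₁ - v =
        (2 * π / L) * (((round ((v + s₁) * L / (2 * π)) : ℤ) : ℝ) - (v + s₁) * L / (2 * π)) := by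
      field_simp
      ring
    rw [e, abs_mul, abs_of_pos (by positivity), abs_sub_comm]
    calc 2 * π / L * |(v + s₁) * L / (2 * π) - ((round ((v + s₁) * L / (2 * π)) : ℤ) : ℝ)|
        ≤ 2 * π / L * (1 / 2) := by gcongr
      _ = π / L := by ring
  calc |Real.cos a + Real.cos (2 * π * ((round ((v + s₁) * L / (2 * π)) : ℤ) : ℝ) / L - s₁) - m|
      = |Real.cos (2 * π * ((round ((v + s₁) * L / (2 * π)) : ℤ) : ℝ) / L - s₁) - Real.cos v| := by
        rw [hv]
        congr 1
        ring
    _ ≤ |2 * π * ((round ((v + s₁) * L / (2 * π)) : ℤ) : ℝ) / L - s₁ - v| := Real.abs_cos_sub_cos_le _ _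
    _ ≤ π / L := hdist

/-- **Lattice momenta near the Fermi curve, uniformly in a grid shift.** For `μ ∈ (-4,4)` there are
`c > 0` and `L₁` such that for all `L ≥ L₁` and every shift `s`,
`c L ≤ #{k ∈ (ℤ/Lℤ)² : |-2 Σᵢ cos(2πkᵢ/L - sᵢ) - μ| ≤ 2π/L}`. [cite: ShastrySutherland1990] -/
theorem exists_card_abs_band_le {μ : ℝ} (hμ : μ ∈ Set.Ioo (-4 : ℝ) 4) :
    ∃ c : ℝ, 0 < c ∧ ∃ L₁ : ℕ, ∀ (L : ℕ) [NeZero L], L₁ ≤ L → ∀ s : Fin 2 → ℝ,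
      c * L ≤ ((Finset.univ.filter fun k : TorusSite 2 L =>
        |-2 * ∑ i : Fin 2, Real.cos (latticeMomentum L k i - s i) - μ| ≤ 2 * π / L).card : ℝ) := by
  obtain ⟨hμ1, hμ2⟩ := hμ
  set m : ℝ := -μ / 2 with hm
  have hmabs : |m| < 2 := by rw [hm, abs_lt]; constructor <;> linarith
  set ε : ℝ := 1 - |m| / 2 with hε
  have hε0 : 0 < ε := by rw [hε]; linarith
  have hε1 : ε ≤ 1 := by rw [hε]; linarith [abs_nonneg m]
  set us : ℝ := Real.arccos (m / 2) with hus
  have hcos_us : Real.cos us = m / 2 := by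
    rw [hus]
    apply Real.cos_arccos <;> linarith [abs_lt.mp hmabs]
  refine ⟨ε / (2 * π), by positivity, ⌈2 * π / ε⌉₊, ?_⟩
  intro L _ hL s
  have hLpos : (0 : ℝ) < L := Nat.cast_pos.mpr (Nat.pos_of_ne_zero (NeZero.ne L))
  have hL' : 2 * π / ε ≤ L := (Nat.le_ceil _).trans (by exact_mod_cast hL)
  have hLε : 2 * π ≤ ε * L := by
    have := (div_le_iff₀ hε0).mp hL'
    linarith
  -- the columns: integers `j₀ + n`, `n < N`
  set j₀ : ℤ := ⌈(s 0 + us - ε) * L / (2 * π)⌉ with hj₀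
  set N : ℕ := ⌊ε * L / π⌋₊ with hN
  have hNle : (N : ℝ) ≤ ε * L / π := Nat.floor_le (by positivity)
  have hNge : ε * L / π - 1 ≤ N := by linarith [Nat.lt_floor_add_one (ε * L / π)]
  have hNltL : (N : ℝ) < L := by
    calc (N : ℝ) ≤ ε * L / π := hNle
      _ ≤ L / π := by gcongr; nlinarith
      _ < L := by rw [div_lt_iff₀ Real.pi_pos]; nlinarith [Real.pi_gt_three]
  -- column angle and its distance to `us`
  have hcol : ∀ n : ℕ, n < N → |2 * π * ((j₀ + n : ℤ) : ℝ) / L - s 0 - us| ≤ ε := by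
    intro n hn
    have h1 : (s 0 + us - ε) * L / (2 * π) ≤ j₀ := Int.le_ceil _
    have h2 : (j₀ : ℝ) < (s 0 + us - ε) * L / (2 * π) + 1 := Int.ceil_lt_add_one _
    have hn' : (n : ℝ) + 1 ≤ N := by exact_mod_cast hn
    have h2π : (0 : ℝ) < 2 * π := by positivity
    rw [abs_le]
    constructor
    · -- lower bound
      have : (s 0 + us - ε) * L ≤ 2 * π * (j₀ : ℝ) := by
        rwa [div_le_iff₀ h2π, mul_comm (j₀ : ℝ)] at h1
      push_cast
      rw [show 2 * π * ((j₀ : ℝ) + n) / L = (2 * π * j₀ + 2 * π * n) / L by ring]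
      rw [le_sub_iff_add_le, le_sub_iff_add_le, le_div_iff₀ hLpos]
      nlinarith [Real.pi_pos, (Nat.cast_nonneg n : (0 : ℝ) ≤ n)]
    · have : 2 * π * (j₀ : ℝ) < (s 0 + us - ε) * L + 2 * π := by
        have h2' := h2
        rw [div_add_one (ne_of_gt h2π), lt_div_iff₀ h2π] at h2'
        linarith
      have hNL : 2 * π * ((n : ℝ) + 1) ≤ 2 * ε * L := by
        have : 2 * π * (N : ℝ) ≤ 2 * ε * L := by
          have := mul_le_mul_of_nonneg_left hNle (le_of_lt h2π)
          rwa [show 2 * π * (ε * L / π) = 2 * ε * L by field_simp] at this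
        nlinarith [Real.pi_pos]
      push_cast
      rw [show 2 * π * ((j₀ : ℝ) + n) / L = (2 * π * j₀ + 2 * π * n) / L by ring]
      rw [sub_le_iff_le_add, sub_le_iff_le_add, div_le_iff₀ hLpos]
      nlinarith [Real.pi_pos]
  -- per column, `|m - cos(column angle)| ≤ 1`
  have hm1 : ∀ n : ℕ, n < N → |m - Real.cos (2 * π * ((j₀ + n : ℤ) : ℝ) / L - s 0)| ≤ 1 := by
    intro n hn
    have hc : |Real.cos (2 * π * ((j₀ + n : ℤ) : ℝ) / L - s 0) - Real.cos us| ≤ ε :=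
      (Real.abs_cos_sub_cos_le _ _).trans (hcol n hn)
    rw [hcos_us] at hc
    calc |m - Real.cos (2 * π * ((j₀ + n : ℤ) : ℝ) / L - s 0)|
        = |m / 2 + (m / 2 - Real.cos (2 * π * ((j₀ + n : ℤ) : ℝ) / L - s 0))| := by
          congr 1
          ring
      _ ≤ |m / 2| + |m / 2 - Real.cos (2 * π * ((j₀ + n : ℤ) : ℝ) / L - s 0)| := abs_add_le _ _
      _ ≤ |m| / 2 + ε := by
          rw [abs_div, abs_two, abs_sub_comm]
          linarith
      _ = 1 := by rw [hε]; ring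
  -- one grid row per column
  choose! b hb using fun (n : ℕ) (hn : n < N) =>
    exists_int_abs_cos_add_cos_sub_le hLpos m (s 1) (2 * π * ((j₀ + n : ℤ) : ℝ) / L - s 0) (hm1 n hn)
  -- the grid points
  let ψ : ℕ → TorusSite 2 L := fun n => ![((j₀ + n : ℤ) : ZMod L), ((b n : ℤ) : ZMod L)]
  have hψ0 : ∀ n, ψ n 0 = ((j₀ + n : ℤ) : ZMod L) := fun n => rfl
  have hψ1 : ∀ n, ψ n 1 = ((b n : ℤ) : ZMod L) := fun n => rfl
  clear_value ψ
  have hμm : μ = -2 * m := by rw [hm]; ring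
  -- each grid point is near the Fermi curve
  have hmem : ∀ n : ℕ, n < N → ψ n ∈ Finset.univ.filter fun k : TorusSite 2 L =>
      |-2 * ∑ i : Fin 2, Real.cos (latticeMomentum L k i - s i) - μ| ≤ 2 * π / L := by
    intro n hn
    rw [Finset.mem_filter]
    refine ⟨Finset.mem_univ _, ?_⟩
    rw [Fin.sum_univ_two, latticeMomentum_eq, latticeMomentum_eq, hψ0, hψ1,
      cos_two_pi_mul_val_intCast_div_sub, cos_two_pi_mul_val_intCast_div_sub, hμm]
    have h := hb n hn
    rw [show -2 * (Real.cos (2 * π * ((j₀ + n : ℤ) : ℝ) / L - s 0) +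
        Real.cos (2 * π * ((b n : ℤ) : ℝ) / L - s 1)) - -2 * m =
        -2 * (Real.cos (2 * π * ((j₀ + n : ℤ) : ℝ) / L - s 0) +
          Real.cos (2 * π * ((b n : ℤ) : ℝ) / L - s 1) - m) by ring, abs_mul, abs_neg, abs_two]
    calc 2 * |Real.cos (2 * π * ((j₀ + n : ℤ) : ℝ) / L - s 0) +
          Real.cos (2 * π * ((b n : ℤ) : ℝ) / L - s 1) - m| ≤ 2 * (π / L) := by gcongr
      _ = 2 * π / L := by ring
  -- the grid points are distinct
  have hNltL' : N < L := by exact_mod_cast hNltL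
  have hinj : Set.InjOn ψ (Finset.range N : Set ℕ) := by
    intro n hn n' hn' h
    have hn : n < N := by simpa using hn
    have hn' : n' < N := by simpa using hn'
    have h0 := congrFun h 0
    rw [hψ0, hψ0, ZMod.intCast_eq_intCast_iff_dvd_sub] at h0
    rw [show (j₀ + (n' : ℤ)) - (j₀ + (n : ℤ)) = (n' : ℤ) - n by ring] at h0
    have hz : (n' : ℤ) - n = 0 := Int.eq_zero_of_abs_lt_dvd h0 (by rw [abs_lt]; constructor <;> omega)
    omega
  -- count
  have hcard : N ≤ (Finset.univ.filter fun k : TorusSite 2 L =>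
      |-2 * ∑ i : Fin 2, Real.cos (latticeMomentum L k i - s i) - μ| ≤ 2 * π / L).card := by
    calc N = (Finset.range N).card := (Finset.card_range N).symm
      _ = ((Finset.range N).image ψ).card := (Finset.card_image_of_injOn hinj).symm
      _ ≤ _ := Finset.card_le_card fun k hk => by
          obtain ⟨n, hn, rfl⟩ := Finset.mem_image.mp hk
          exact hmem n (Finset.mem_range.mp hn)
  have h1 : 1 ≤ ε * L / (2 * π) := by rw [le_div_iff₀ (by positivity)]; linarith
  calc ε / (2 * π) * L = ε * L / π - ε * L / (2 * π) := by ring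
    _ ≤ ε * L / π - 1 := by linarith
    _ ≤ N := hNge
    _ ≤ _ := by exact_mod_cast hcard

end Literature.MathematicalPhysics.QuantumLattice
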